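import Mathlib
import Literature.NumberTheory.LFunctions.Zhang2022.Section11AFEWindowTools
import Literature.NumberTheory.LFunctions.Zhang2022.Section6ZfacBound
import HarnessLib

/-!
# Zhang (2022) §11, proof of Lemma 11.2 for `χψ` — tools for (6.2): the reflected tail, the
# rectangle `[−𝓛⁹, −1] × [−𝓛²⁰, 𝓛²⁰]` and the pointwise size of the (6.2)-integrand on it

Topic `Literature/NumberTheory/LFunctions/Zhang2022` (Landau–Siegel audit tree; verdict-neutral).
Y. Zhang, *Discrete mean estimates and the Landau–Siegel zero*, arXiv:2211.02515v1 (2022)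
[Zhang2022LandauSiegel] — **an unrefereed manuscript under adjudication** (campaign D-0069; nothing
here bears on Theorems 1–2 or on Landau–Siegel zeros). Companion of `Section11AFEObjects` (where
the sub-step (d) `TailSmall11` of `Z22:§11.u024` is typed) and of `Section11AFELineIntegrability` /
`Section11AFEWindowTools`. DAG node served: `Z22:§11.u024` sub-step (d) = the §6 display
`Z22:(6.2)` (tex L1729–1754) for the character `χψ (mod Dp)`:
"`∫_{(−1)} Z(s+w,χψ)(Σ_{n≥P₁}χψ̄(n)n^{−(1−s−w)})X^wω₁(w)dw/w ≪ ε`", `X = P^z`.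

PROVED here (theorem-only; 0 new definitions, 0 new facts):
* `norm_tailPc_le` — the trivial estimate for the reflected tail on `Re w = u ≤ −1`, `σ = 1/2`:
  `‖Σ_{n≥⌈N⌉}χψ̄(n)n^{−(1−s−w)}‖ ≤ 3N^{1/2+u}` (integral test; §6 p. 32 "`Σ_{n≥T³} … ≪ T^{3u+1/2}`",
  here with the honest exponent `u + 1/2` since `σ = 1/2` exactly);
* `differentiableAt_integrandTail` — the (6.2)-integrand is holomorphic at `w ≠ 0` with
  `Im(s+w) > 0`, `Re(1−s−w) > 1`;
* `rect_integrandTail` — "We move the contour of integration in (6.2) to the vertical segments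
  `u = −1, |v| > 𝓛²⁰` and `u = −𝓛⁹, |v| ≤ 𝓛²⁰` with the horizontal connecting segments"
  (§6 pp. 31–32, tex L1735–1745): Cauchy's theorem on `[−𝓛⁹,−1] × [−𝓛²⁰,𝓛²⁰]`
  (Mathlib `integral_boundary_rect_eq_zero_of_differentiableOn`);
* `ratio_le_exp_neg_ell` — the decay ratio `Dp(t+v)/(2π·P^z·P₁) ≤ e^{−𝓛}` (`p ≤ 9P/8`,
  `t + v ≤ 11𝓛⁵¹⁹`, `P^zP₁ ≥ P^{1.004}`, `𝓛 ≥ 5`);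
* `norm_integrandTail_inner_le` — on `−𝓛⁹ ≤ u ≤ −1`, `|v| ≤ 𝓛²⁰`:
  `‖integrand(u+iv)‖ ≤ 12√P₁·e^{𝓛u}·e^{(u²−v²)/(4𝓛³⁰)}` (Stirling for `Z(·,χψ)` with `A = 𝓛⁹`,
  the tree's `Section6TailBounds.norm_Zfac_le`, `σ = 1/2` so that `|Z(s+w,χψ)| ≤ 4(k(t+v)/2π)^{−u}`).

## References

* Y. Zhang, arXiv:2211.02515v1 (2022), §6 proof of Lemma 6.1, (6.2) pp. 31–32; §11 Lemma 11.2
  p. 65; §2 (2.4), (2.6), (2.8), (2.21). [cite: Zhang2022LandauSiegel, §6 (6.2); §11 Lemma 11.2]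
* E. C. Titchmarsh, *The Theory of the Riemann Zeta-Function*, 2nd ed. (1986), §4.12 (4.12.3).
  [cite: Titchmarsh1986, §4.12 (4.12.3)]
-/

noncomputable section

open Complex Real ComplexConjugate MeasureTheory Set Filter Topology

namespace Literature.NumberTheory.LFunctions.Zhang2022.Section11AFE

open Skeleton GaussWeight Section6Statements

section BlockD

variable {D : ℕ} [NeZero D] (χ : DirichletCharacter ℂ D) (x : Chr D)

/-! ## §1. The range of Lemma 11.2 inside the range of Lemma 6.1; parameters -/

omit [NeZero D] in
/-- The range of Lemma 11.2 (`σ = 1/2`, `|t − 2πt₀| < 𝓛₁`) lies in the range of Lemma 6.1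
(`|σ − 1/2| < 2α`, `|t − 2πt₀| < 𝓛₁ + 2`), `D ≥ 9`. [cite: Zhang2022LandauSiegel, §6 Lemma 6.1; §11 Lemma 11.2] -/
theorem inRange61_of_inRange112 (hD : 9 ≤ D) {s : ℂ} (hs : InRange112 D s) : InRange61 D s := by
  obtain ⟨hre, him⟩ := hs
  have hℓ : 0 < ell D := by linarith [Section6TailBounds.two_le_ell hD]
  have hα : 0 < alpha D := by
    rw [Section2.alpha_eq_pi_div_ell9]; exact div_pos Real.pi_pos (pow_pos hℓ 9)
  refine ⟨?_, by linarith⟩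
  rw [hre, sub_self, abs_zero]
  linarith

omit [NeZero D] in
/-- `P₁ = P^{0.504} ≥ 1` and `√P₁ = e^{0.252𝓛⁹}`. [cite: Zhang2022LandauSiegel, §2 (2.21)] -/
theorem one_le_P1_and_sqrt (D : ℕ) :
    1 ≤ Skeleton.P1 D ∧ Real.sqrt (Skeleton.P1 D) = Real.exp (0.252 * ell D ^ 9) := by
  have hP1 : Skeleton.P1 D = Real.exp (0.504 * ell D ^ 9) := by
    rw [Skeleton.P1, bigP, ← Real.exp_mul]; ring_nf
  refine ⟨?_, ?_⟩
  · rw [hP1]; exact Real.one_le_exp (mul_nonneg (by norm_num) (pow_nonneg (Real.log_natCast_nonneg D) 9))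
  · rw [hP1, Real.sqrt_eq_rpow, ← Real.exp_mul]; ring_nf

/-! ## §2. The reflected tail: the trivial estimate and holomorphy -/

omit [NeZero D] in
/-- For `a > 1` and `M ≥ 1`: `Σ_{k ≥ 0} (k+M+1)^{−a} ≤ M^{1−a}/(a−1)` (integral test).
[folklore] -/
private theorem tsum_rpow_neg_shift_le {a : ℝ} (ha : 1 < a) {M : ℕ} (hM : 1 ≤ M) :
    ∑' k : ℕ, ((k + M + 1 : ℕ) : ℝ) ^ (-a) ≤ (M : ℝ) ^ (1 - a) / (a - 1) := by
  have hM0 : (0 : ℝ) < M := by exact_mod_cast hM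
  have anti : AntitoneOn (fun y : ℝ => y ^ (-a)) (Ici (M : ℝ)) :=
    (Real.antitoneOn_rpow_Ioi_of_exponent_nonpos (by linarith)).mono
      fun y hy => lt_of_lt_of_le hM0 hy
  have integrable : IntegrableOn (fun y : ℝ => y ^ (-a)) (Ioi (M : ℝ)) :=
    integrableOn_Ioi_rpow_of_lt (by linarith) hM0
  have nonneg : ∀ y ∈ Ioi (M : ℝ), 0 ≤ y ^ (-a) := fun y hy =>
    Real.rpow_nonneg (hM0.trans hy).le _
  have h := anti.tsum_comp_add_le_integral M integrable nonneg
  rw [integral_Ioi_rpow_of_lt (by linarith) hM0] at h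
  have e : -(M : ℝ) ^ (-a + 1) / (-a + 1) = (M : ℝ) ^ (1 - a) / (a - 1) := by
    rw [show -a + 1 = -(a - 1) by ring, neg_div_neg_eq, show -(a - 1) = 1 - a by ring]
  rw [e] at h
  exact h

omit [NeZero D] in
/-- For `a ≥ 3/2` and `M ≥ 1`: `Σ_{k ≥ 0} (k+M)^{−a} ≤ 3M^{1−a}`. [folklore] -/
private theorem tsum_rpow_neg_shift_le' {a : ℝ} (ha : 3 / 2 ≤ a) {M : ℕ} (hM : 1 ≤ M) :
    ∑' k : ℕ, ((k + M : ℕ) : ℝ) ^ (-a) ≤ 3 * (M : ℝ) ^ (1 - a) := by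
  have ha1 : 1 < a := by linarith
  have hM1 : (1 : ℝ) ≤ M := by exact_mod_cast hM
  have hs : Summable fun k : ℕ => ((k + M : ℕ) : ℝ) ^ (-a) :=
    (Real.summable_nat_rpow.2 (by linarith : -a < -1)).comp_injective (add_left_injective M)
  rw [hs.tsum_eq_zero_add]
  have e : ∀ k : ℕ, ((k + 1 + M : ℕ) : ℝ) ^ (-a) = ((k + M + 1 : ℕ) : ℝ) ^ (-a) := by
    intro k; rw [Nat.add_right_comm]
  simp only [zero_add, e]
  have h1 := tsum_rpow_neg_shift_le ha1 hM
  have hpow : (M : ℝ) ^ (-a) ≤ (M : ℝ) ^ (1 - a) :=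
    Real.rpow_le_rpow_of_exponent_le hM1 (by linarith)
  have hpos : 0 ≤ (M : ℝ) ^ (1 - a) := Real.rpow_nonneg (by linarith) _
  have hdiv : (M : ℝ) ^ (1 - a) / (a - 1) ≤ 2 * (M : ℝ) ^ (1 - a) := by
    rw [div_le_iff₀ (by linarith)]; nlinarith
  linarith

omit [NeZero D] in
/-- `χψ(0) = 0` (`p` is prime, so `0` is a non-unit mod `p`). [cite: Zhang2022LandauSiegel, §4 p. 8] -/
theorem pc_zero : pc χ x 0 = 0 := by
  rw [pc, Nat.cast_zero, MulChar.map_nonunit x.ψ not_isUnit_zero, zero_mul]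

omit [NeZero D] in
/-- **The trivial estimate for the reflected tail** on `Re w = u ≤ −1`, `σ = 1/2` (§6 p. 32,
"`Σ_{n≥T³}ψ̄(n)n^{−(1−s−w)} ≪ T^{3u+1/2}`", for `χψ` and the length `N`): for `N ≥ 1`,
`‖Σ_{n≥⌈N⌉}χψ̄(n)n^{−(1−s−w)}‖ ≤ 3N^{1/2+u}` (`|χψ̄(n)| ≤ 1`, `Re(1−s−w) = 1/2 − u ≥ 3/2`,
integral test). [cite: Zhang2022LandauSiegel, §6 (6.2) p. 32, tex L1751] -/
theorem norm_tailPc_le {s : ℂ} (hs : s.re = 1 / 2) {N : ℝ} (hN : 1 ≤ N) {u : ℝ} (hu : u ≤ -1)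
    (v : ℝ) : ‖tailPc χ x N s ((u : ℂ) + (v : ℂ) * I)‖ ≤ 3 * N ^ (1 / 2 + u) := by
  set a : ℝ := 1 / 2 - u with ha_def
  have ha : 3 / 2 ≤ a := by rw [ha_def]; linarith
  set M : ℕ := ⌈N⌉₊ with hM_def
  have hN0 : 0 < N := by linarith
  have hM1 : 1 ≤ M := Nat.one_le_ceil_iff.mpr hN0
  have hNM : N ≤ (M : ℝ) := Nat.le_ceil _
  have hM0 : (0 : ℝ) < M := by exact_mod_cast hM1
  have hre : (-(1 - s - ((u : ℂ) + (v : ℂ) * I))).re = -a := by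
    simp [hs, ha_def]; ring
  -- the majorant
  set g : ℕ → ℝ := fun n => if M ≤ n then (n : ℝ) ^ (-a) else 0 with hg_def
  have hg_nonneg : ∀ n, 0 ≤ g n := by
    intro n; simp only [hg_def]
    split_ifs
    · exact Real.rpow_nonneg (Nat.cast_nonneg n) _
    · exact le_rfl
  have hmaj : Summable fun n : ℕ => (n : ℝ) ^ (-a) :=
    Real.summable_nat_rpow.2 (by linarith : -a < -1)
  have hg_le : ∀ n, g n ≤ (n : ℝ) ^ (-a) := by
    intro n; simp only [hg_def]
    split_ifs
    · exact le_rfl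
    · exact Real.rpow_nonneg (Nat.cast_nonneg n) _
  have hgs : Summable g := Summable.of_nonneg_of_le hg_nonneg hg_le hmaj
  have hterm : ∀ n : ℕ,
      ‖(if M ≤ n then conj (pc χ x n) * (n : ℂ) ^ (-(1 - s - ((u : ℂ) + (v : ℂ) * I))) else 0)‖
        ≤ g n := by
    intro n
    simp only [hg_def]
    split_ifs with h
    · have hn0 : 0 < n := lt_of_lt_of_le (by omega) h
      rw [norm_mul, Complex.norm_natCast_cpow_of_pos hn0, hre, Complex.norm_conj]
      have h1 : ‖pc χ x n‖ ≤ 1 := by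
        rw [pc, norm_mul]
        exact mul_le_one₀ (x.ψ.norm_le_one _) (norm_nonneg _) (χ.norm_le_one _)
      have h0 : 0 ≤ (n : ℝ) ^ (-a) := Real.rpow_nonneg (Nat.cast_nonneg n) _
      nlinarith
    · simp
  have hbound : ‖tailPc χ x N s ((u : ℂ) + (v : ℂ) * I)‖ ≤ ∑' n, g n :=
    tsum_of_norm_bounded hgs.hasSum hterm
  have hsplit : ∑' n, g n = ∑' k : ℕ, ((k + M : ℕ) : ℝ) ^ (-a) := by
    rw [← hgs.sum_add_tsum_nat_add M]
    have hzero : ∑ i ∈ Finset.range M, g i = 0 := by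
      refine Finset.sum_eq_zero fun i hi => ?_
      simp only [hg_def, if_neg (not_le.mpr (Finset.mem_range.mp hi))]
    rw [hzero, zero_add]
    refine tsum_congr fun k => ?_
    simp only [hg_def, if_pos (Nat.le_add_left M k)]
  have htail := tsum_rpow_neg_shift_le' ha hM1
  have hmono : (M : ℝ) ^ (1 - a) ≤ N ^ (1 - a) :=
    Real.rpow_le_rpow_of_nonpos hN0 hNM (by linarith)
  have hexp : 1 - a = 1 / 2 + u := by rw [ha_def]; ring
  calc ‖tailPc χ x N s ((u : ℂ) + (v : ℂ) * I)‖ ≤ ∑' n, g n := hbound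
    _ = ∑' k : ℕ, ((k + M : ℕ) : ℝ) ^ (-a) := hsplit
    _ ≤ 3 * (M : ℝ) ^ (1 - a) := htail
    _ ≤ 3 * N ^ (1 - a) := by linarith
    _ = 3 * N ^ (1 / 2 + u) := by rw [hexp]

omit [NeZero D] in
/-- The reflected tail is the Dirichlet series, at `1 − s − w`, of the bounded sequence
`χψ̄·𝟙_{n ≥ ⌈N⌉}`. [cite: Zhang2022LandauSiegel, §6 (6.2) p. 31] -/
theorem tailPc_eq_LSeries (N : ℝ) (s w : ℂ) :
    tailPc χ x N s w =
      LSeries (fun n : ℕ => if ⌈N⌉₊ ≤ n then conj (pc χ x n) else 0) (1 - s - w) := by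
  rw [tailPc, LSeries]
  refine tsum_congr fun n => ?_
  have h0 : (fun n : ℕ => if ⌈N⌉₊ ≤ n then conj (pc χ x n) else 0) 0 = 0 := by
    simp [pc_zero χ x]
  rw [LSeries.term_def₀ h0]
  split_ifs <;> simp

omit [NeZero D] in
/-- The reflected tail is holomorphic in `w` wherever `Re(1 − s − w) > 1`.
[cite: Zhang2022LandauSiegel, §6 (6.2) p. 31] -/
theorem differentiableAt_tailPc (N : ℝ) (s : ℂ) {w : ℂ} (hw : 1 < (1 - s - w).re) :
    DifferentiableAt ℂ (tailPc χ x N s) w := by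
  set a : ℕ → ℂ := fun n => if ⌈N⌉₊ ≤ n then conj (pc χ x n) else 0 with ha
  have hfun : tailPc χ x N s = fun w => LSeries a (1 - s - w) := by
    funext w; rw [tailPc_eq_LSeries]
  have habs : LSeries.abscissaOfAbsConv a ≤ 1 := by
    refine LSeries.abscissaOfAbsConv_le_of_le_const ⟨1, fun n _ => ?_⟩
    simp only [ha]
    split_ifs
    · rw [Complex.norm_conj, pc, norm_mul]
      exact mul_le_one₀ (x.ψ.norm_le_one _) (norm_nonneg _) (χ.norm_le_one _)
    · simp
  have hlt : LSeries.abscissaOfAbsConv a < ((1 - s - w).re : EReal) :=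
    lt_of_le_of_lt habs (by exact_mod_cast hw)
  have hL : DifferentiableAt ℂ (LSeries a) (1 - s - w) := (LSeries_hasDerivAt hlt).differentiableAt
  have hlin : DifferentiableAt ℂ (fun w : ℂ => 1 - s - w) w := by fun_prop
  rw [hfun]
  exact hL.comp w hlin

omit [NeZero D] in
/-- The Perron kernel `X^wω₁(w)/w` is holomorphic away from `w = 0` (`X > 0`).
[cite: Zhang2022LandauSiegel, §6 (6.1) p. 31] -/
theorem differentiableAt_kern11 {X : ℝ} (hX : 0 < X) {w : ℂ} (hw : w ≠ 0) :
    DifferentiableAt ℂ (kern D X) w := by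
  have hXne : ((X : ℝ) : ℂ) ≠ 0 := Complex.ofReal_ne_zero.mpr hX.ne'
  have h1 : DifferentiableAt ℂ (fun w : ℂ => ((X : ℝ) : ℂ) ^ w) w :=
    differentiableAt_id.const_cpow (Or.inl hXne)
  have h2 : DifferentiableAt ℂ (omega1 (ell D ^ 30)) w := by
    unfold omega1; fun_prop
  unfold kern
  exact (h1.mul h2).div differentiableAt_id hw

/-- **The (6.2)-integrand for `χψ` is holomorphic** at every `w ≠ 0` with `Im(s+w) > 0` and
`Re(1−s−w) > 1`. [cite: Zhang2022LandauSiegel, §6 (6.2) pp. 31–32] -/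
theorem differentiableAt_integrandTail {X : ℝ} (hX : 0 < X) (N : ℝ) (s : ℂ) {w : ℂ} (hw : w ≠ 0)
    (him : 0 < (s + w).im) (hre : 1 < (1 - s - w).re) :
    DifferentiableAt ℂ (integrandTail χ x X N s) w := by
  have hZ : DifferentiableAt ℂ (fun w => Zpc χ x (s + w)) w := by
    have hz := GammaFactor.differentiableAt_Zfac (psiChi χ x) him
    exact DifferentiableAt.comp (g := Zpc χ x) w hz ((differentiableAt_const s).add differentiableAt_id)
  unfold integrandTail
  exact (hZ.mul (differentiableAt_tailPc χ x N s hre)).mul (differentiableAt_kern11 hX hw)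

/-! ## §3. The rectangle `[−𝓛⁹, −1] × [−𝓛²⁰, 𝓛²⁰]` -/

/-- **The contour move of (6.2) for `χψ`** (§6 pp. 31–32, tex L1735–1745: "We move the contour of
integration in (6.2) to the vertical segments `u = −1, |v| > 𝓛²⁰` and `u = −𝓛⁹, |v| ≤ 𝓛²⁰` with the
horizontal connecting segments `−𝓛⁹ ≤ u ≤ −1, |v| = 𝓛²⁰`"): for `D ≥ 9`, `s` in the range of
Lemma 11.2 and `X > 0`, the integral of the (6.2)-integrand over `[−1−i𝓛²⁰, −1+i𝓛²⁰]` equals the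
integral over the three-sided path through `u = −𝓛⁹` (Cauchy's theorem: the integrand is
holomorphic on a neighbourhood of the rectangle, `Im(s+w) ≥ 𝓛⁵¹⁹ − 𝓛²⁰ > 0`, `Re(1−s−w) ≥ 3/2`).
[cite: Zhang2022LandauSiegel, §6 pp. 31–32, tex L1735–1745; §11 p. 65] -/
theorem rect_integrandTail (hD : 9 ≤ D) {s : ℂ} (hs : InRange112 D s) {X : ℝ} (hX : 0 < X)
    (N : ℝ) :
    I * (∫ v in (-(ell D ^ 20))..(ell D ^ 20),
        integrandTail χ x X N s (((-1 : ℝ) : ℂ) + (v : ℂ) * I)) =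
      (∫ u in (-1 : ℝ)..(-(ell D ^ 9)),
          integrandTail χ x X N s ((u : ℂ) + ((-(ell D ^ 20) : ℝ) : ℂ) * I)) +
        I * (∫ v in (-(ell D ^ 20))..(ell D ^ 20),
          integrandTail χ x X N s (((-(ell D ^ 9) : ℝ) : ℂ) + (v : ℂ) * I)) +
        ∫ u in (-(ell D ^ 9))..(-1 : ℝ),
          integrandTail χ x X N s ((u : ℂ) + ((ell D ^ 20 : ℝ) : ℂ) * I) := by
  have hr61 := inRange61_of_inRange112 hD hs
  obtain ⟨hre, _⟩ := hs
  obtain ⟨him, _⟩ := Section6TailBounds.im_add_range hD hr61 (v := -(ell D ^ 20))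
    (by rw [abs_neg, abs_of_nonneg (by positivity)])
  have hℓ := Section6TailBounds.two_le_ell hD
  set L : ℝ := ell D ^ 9 with hL
  set V : ℝ := ell D ^ 20 with hV
  have h1 : (1 : ℝ) ≤ ell D := by linarith
  have hL1 : 1 ≤ L := one_le_pow₀ h1
  have hV0 : 0 ≤ V := by positivity
  have h519 : (2 : ℝ) ≤ ell D ^ 519 := Section6TailBounds.two_le_ell_pow hD (by norm_num)
  set f : ℂ → ℂ := integrandTail χ x X N s with hf
  set z : ℂ := ⟨-L, -V⟩ with hz
  set w : ℂ := ⟨-1, V⟩ with hw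
  -- holomorphy on the closed rectangle `[−L,−1] × [−V,V]`
  have hdiff : DifferentiableOn ℂ f (Set.uIcc z.re w.re ×ℂ Set.uIcc z.im w.im) := by
    intro q hq
    have hq' : q.re ∈ Set.uIcc (-L) (-1) ∧ q.im ∈ Set.uIcc (-V) V := by
      simpa [hz, hw, Complex.mem_reProdIm] using hq
    obtain ⟨hqre, hqim⟩ := hq'
    rw [Set.uIcc_of_le (by linarith), Set.mem_Icc] at hqre
    rw [Set.uIcc_of_le (by linarith), Set.mem_Icc] at hqim
    have hq0 : q ≠ 0 := by
      intro h; rw [h] at hqre; simp at hqre; linarith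
    have him' : 0 < (s + q).im := by
      rw [add_im]; linarith
    have hre' : 1 < (1 - s - q).re := by simp [hre]; linarith
    exact (differentiableAt_integrandTail χ x hX N s hq0 him' hre').differentiableWithinAt
  have key := Complex.integral_boundary_rect_eq_zero_of_differentiableOn f z w hdiff
  have hzre : z.re = -L := rfl
  have hzim : z.im = -V := rfl
  have hwre : w.re = -1 := rfl
  have hwim : w.im = V := rfl
  rw [hzre, hzim, hwre, hwim] at key
  simp only [smul_eq_mul] at key
  have e1 : (∫ y : ℝ in (-V)..V, f ((↑(-1 : ℝ) : ℂ) + y * I)) =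
      ∫ y : ℝ in (-V)..V, f (((-1 : ℝ) : ℂ) + (y : ℂ) * I) := rfl
  rw [intervalIntegral.integral_symm (-L) (-1 : ℝ)]
  linear_combination key

/-! ## §4. The size of the (6.2)-integrand on `−𝓛⁹ ≤ u ≤ −1`, `|v| ≤ 𝓛²⁰` -/

omit [NeZero D] in
/-- `B^{−u}X^uP^u = (B/(XP))^{−u}` for positive reals. [folklore] -/
private theorem rpow_ratio_eq {B X P u : ℝ} (hB : 0 < B) (hX : 0 < X) (hP : 0 < P) :
    B ^ (-u) * (X ^ u * P ^ u) = (B / (X * P)) ^ (-u) := by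
  have hXP : 0 < X * P := mul_pos hX hP
  rw [Real.div_rpow hB.le hXP.le, Real.rpow_neg hXP.le, div_inv_eq_mul, Real.mul_rpow hX.le hP.le]

omit [NeZero D] in
/-- **The decay ratio**: for `𝓛 ≥ 5`, `p ≤ 9P/8`, `0 < t′ ≤ 11𝓛⁵¹⁹` and `0.5 ≤ z`:
`Dpt′/(2π·P^z·P₁) ≤ e^{−𝓛}` (`P^zP₁ ≥ P^{1.004}`, `2D𝓛⁵¹⁹ ≤ e^{1+520𝓛} ≤ e^{0.004𝓛⁹−𝓛}`).
[cite: Zhang2022LandauSiegel, §2 (2.6), (2.8), (2.21); §6 p. 32 ("`(2T²)^{−u}`")] -/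
theorem ratio_le_exp_neg_ell (hL : 5 ≤ ell D) {p t' z : ℝ}
    (hp : p ≤ 9 / 8 * bigP D) (ht0 : 0 < t') (ht : t' ≤ 11 * ell D ^ 519) (hz : 0.5 ≤ z) :
    (D : ℝ) * p * t' / (2 * π) / (bigP D ^ z * Skeleton.P1 D) ≤ Real.exp (-ell D) := by
  set ℓ : ℝ := ell D with hℓ
  have hℓ0 : 0 < ℓ := by linarith
  have hP : 0 < bigP D := Real.exp_pos _
  have hP1 : (1 : ℝ) ≤ bigP D := Real.one_le_exp (by rw [← hℓ]; positivity)
  have hlogD : 0 < Real.log (D : ℝ) := by have h := hℓ0; rwa [hℓ, ell] at h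
  have hD1 : (1 : ℝ) < D := by
    by_contra h
    push Not at h
    have := Real.log_nonpos (by positivity) h
    linarith
  have hD0 : (0 : ℝ) < D := by linarith
  have hDexp : (D : ℝ) = Real.exp ℓ := by
    rw [hℓ, ell, Real.exp_log hD0]
  -- denominator `P^z P₁ ≥ P^{1.004} = e^{1.004 ℓ⁹}`
  have hden : Real.exp (1.004 * ℓ ^ 9) ≤ bigP D ^ z * Skeleton.P1 D := by
    rw [Skeleton.P1, ← Real.rpow_add hP]
    have h1 : Real.exp (1.004 * ℓ ^ 9) = bigP D ^ (1.004 : ℝ) := by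
      rw [bigP, ← Real.exp_mul, hℓ]; ring_nf
    rw [h1]
    exact Real.rpow_le_rpow_of_exponent_le hP1 (by linarith)
  have hden0 : 0 < bigP D ^ z * Skeleton.P1 D := lt_of_lt_of_le (Real.exp_pos _) hden
  -- numerator `D p t′/(2π) ≤ 2 D P ℓ⁵¹⁹ ≤ e^{1 + 520ℓ} · e^{ℓ⁹}`
  have hnum : (D : ℝ) * p * t' / (2 * π) ≤ Real.exp (1 + 520 * ℓ + ℓ ^ 9) := by
    have hπ := Real.pi_gt_three
    have h2 : (2 : ℝ) ≤ Real.exp 1 := by have := Real.add_one_le_exp (1 : ℝ); linarith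
    have hl519 : ℓ ^ 519 ≤ Real.exp (519 * ℓ) := by
      have := Real.add_one_le_exp ℓ
      calc ℓ ^ 519 ≤ (Real.exp ℓ) ^ 519 := pow_le_pow_left₀ hℓ0.le (by linarith) 519
        _ = Real.exp (519 * ℓ) := by rw [← Real.exp_nat_mul]; norm_num
    have hst : (D : ℝ) * p * t' / (2 * π) ≤ 2 * D * bigP D * ℓ ^ 519 := by
      rw [div_le_iff₀ (by positivity)]
      have hπ' := Real.pi_gt_d2
      have hM : 0 ≤ (D : ℝ) * bigP D * ℓ ^ 519 :=
        mul_nonneg (mul_nonneg hD0.le hP.le) (pow_nonneg hℓ0.le _)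
      calc (D : ℝ) * p * t' ≤ D * (9 / 8 * bigP D) * (11 * ℓ ^ 519) := by gcongr
        _ = 99 / 8 * ((D : ℝ) * bigP D * ℓ ^ 519) := by ring
        _ ≤ 4 * π * ((D : ℝ) * bigP D * ℓ ^ 519) := by nlinarith
        _ = 2 * D * bigP D * ℓ ^ 519 * (2 * π) := by ring
    refine hst.trans ?_
    rw [show 1 + 520 * ℓ + ℓ ^ 9 = 1 + ℓ + 519 * ℓ + ℓ ^ 9 by ring, Real.exp_add, Real.exp_add,
      Real.exp_add, ← hDexp]
    have : bigP D = Real.exp (ℓ ^ 9) := rfl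
    rw [this]
    calc 2 * (D : ℝ) * Real.exp (ℓ ^ 9) * ℓ ^ 519
        = 2 * D * ℓ ^ 519 * Real.exp (ℓ ^ 9) := by ring
      _ ≤ Real.exp 1 * D * Real.exp (519 * ℓ) * Real.exp (ℓ ^ 9) := by gcongr
  -- compare exponents: `1 + 520ℓ + ℓ⁹ ≤ 1.004ℓ⁹ − ℓ` for `ℓ ≥ 5`
  have hcmp : 1 + 520 * ℓ + ℓ ^ 9 ≤ 1.004 * ℓ ^ 9 + -ℓ := by
    have h8 : (390625 : ℝ) ≤ ℓ ^ 8 := by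
      calc (390625 : ℝ) = 5 ^ 8 := by norm_num
        _ ≤ ℓ ^ 8 := pow_le_pow_left₀ (by norm_num) hL 8
    have e9 : ℓ ^ 9 = ℓ ^ 8 * ℓ := by ring
    nlinarith
  rw [div_le_iff₀ hden0]
  calc (D : ℝ) * p * t' / (2 * π) ≤ Real.exp (1 + 520 * ℓ + ℓ ^ 9) := hnum
    _ ≤ Real.exp (1.004 * ℓ ^ 9 + -ℓ) := Real.exp_le_exp.mpr hcmp
    _ = Real.exp (-ℓ) * Real.exp (1.004 * ℓ ^ 9) := by rw [Real.exp_add, mul_comm]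
    _ ≤ Real.exp (-ℓ) * (bigP D ^ z * Skeleton.P1 D) := by gcongr

/-- **The (6.2)-integrand for `χψ` on `−𝓛⁹ ≤ u ≤ −1`, `|v| ≤ 𝓛²⁰`** (§6 p. 32: "by (4.) we have
`Z(s+w,ψ)P₄^w ≪ (2T²)^{−u}` and `Σ_{n≥T³}ψ̄(n)n^{−(1−s−w)} ≪ T^{3u+1/2}`", for `χψ`, `X = P^z`,
`N = P₁`): for `D ≥ ⌈e⁵⌉` (and `D ≥ 9`), `s` in the range of Lemma 11.2, `0.5 ≤ z`,
`‖Z(s+w,χψ)·tail·X^wω₁(w)/w‖ ≤ 12√P₁·e^{𝓛u}·e^{(u²−v²)/(4𝓛³⁰)}` — Stirling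
(`Section6TailBounds.norm_Zfac_le`, `A = 𝓛⁹`, `σ = 1/2`: `|Z(s+w,χψ)| ≤ 4(Dp(t+v)/2π)^{−u}`),
`|X^w| = X^u`, `norm_tailPc_le`, and `(Dp(t+v)/(2πXP₁))^{−u} ≤ e^{𝓛u}` (`ratio_le_exp_neg_ell`).
[cite: Zhang2022LandauSiegel, §6 (6.2) p. 32, tex L1747–1751; §11 p. 65] -/
theorem norm_integrandTail_inner_le (hD : 9 ≤ D) (hL : 5 ≤ ell D) (hp : χ.IsPrimitive) {s : ℂ}
    (hs : InRange112 D s) {z : ℝ} (hz : 0.5 ≤ z) {u v : ℝ} (hu9 : -(ell D ^ 9) ≤ u) (hu1 : u ≤ -1)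
    (hv : |v| ≤ ell D ^ 20) :
    ‖integrandTail χ x (bigP D ^ z) (Skeleton.P1 D) s ((u : ℂ) + (v : ℂ) * I)‖ ≤
      12 * Real.sqrt (Skeleton.P1 D) * Real.exp (ell D * u) *
        Real.exp ((u ^ 2 - v ^ 2) / (4 * ell D ^ 30)) := by
  have hr61 := inRange61_of_inRange112 hD hs
  obtain ⟨hre, _⟩ := hs
  have hD3 : 3 ≤ D := le_trans (by norm_num) hD
  have hℓ0 : 0 < ell D := by linarith
  have hP : 0 < bigP D := Real.exp_pos _
  have hX : 0 < bigP D ^ z := Real.rpow_pos_of_pos hP z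
  obtain ⟨hP1one, hsqrt⟩ := one_le_P1_and_sqrt D
  have hP10 : 0 < Skeleton.P1 D := by linarith
  obtain ⟨htlo, hthi⟩ := Section6TailBounds.im_add_range hD hr61 hv
  have hσu := Section6TailBounds.abs_re_add_le hD hr61 hu9 hu1
  obtain ⟨hp1, hp2⟩ := Section6TailBounds.p_range hD x
  have hp0 : (0 : ℝ) < x.p := hP.trans hp1
  -- the point `s′ = s + w` and Stirling for `Z(·,χψ)`
  set θ := psiChi χ x with hθ
  have hprim : θ.IsPrimitive := psiChiPrimitive_holds D χ x hD3 hp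
  set s' : ℂ := s + ((u : ℂ) + (v : ℂ) * I) with hs'
  have hre' : s'.re = s.re + u := by simp [hs']
  have him' : s'.im = s.im + v := by simp [hs']
  have ht1 : 1 ≤ s'.im := by
    rw [him']; linarith [Section6TailBounds.two_le_ell_pow hD (n := 519) (by norm_num)]
  have hA : (1 : ℝ) ≤ ell D ^ 9 := by
    linarith [Section6TailBounds.two_le_ell_pow hD (n := 9) (by norm_num)]
  have hσA : |s'.re| ≤ ell D ^ 9 := by rw [hre']; exact hσu
  have htA : 38 * (ell D ^ 9 + 1) ^ 2 ≤ s'.im := by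
    rw [him']; exact (Section6TailBounds.stirling_threshold_le hD).trans htlo
  have hZ := Section6TailBounds.norm_Zfac_le hprim hA hσA ht1 htA
  rw [hre', him', hre] at hZ
  have hk : ((D * x.p : ℕ) : ℝ) = (D : ℝ) * x.p := by push_cast; ring
  rw [hk, show (1 / 2 - (1 / 2 + u) : ℝ) = -u by ring] at hZ
  -- the base `B = Dp(t+v)/2π` and the ratio
  set B : ℝ := (D : ℝ) * x.p * (s.im + v) / (2 * π) with hB
  have ht'0 : 0 < s.im + v := by linarith [Section6TailBounds.two_le_ell_pow hD (n := 519) (by norm_num)]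
  have hD0 : (0 : ℝ) < D := by exact_mod_cast Nat.pos_of_ne_zero (NeZero.ne D)
  have hB0 : 0 < B := by rw [hB]; positivity
  have hρ : B / (bigP D ^ z * Skeleton.P1 D) ≤ Real.exp (-ell D) :=
    ratio_le_exp_neg_ell hL hp2 ht'0 hthi hz
  have hρ0 : 0 ≤ B / (bigP D ^ z * Skeleton.P1 D) := div_nonneg hB0.le (mul_pos hX hP10).le
  have hu0 : 0 ≤ -u := by linarith
  have hρu : (B / (bigP D ^ z * Skeleton.P1 D)) ^ (-u) ≤ Real.exp (ell D * u) := by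
    calc (B / (bigP D ^ z * Skeleton.P1 D)) ^ (-u) ≤ (Real.exp (-ell D)) ^ (-u) :=
          Real.rpow_le_rpow hρ0 hρ hu0
      _ = Real.exp (ell D * u) := by rw [← Real.exp_mul]; ring_nf
  -- the four factors
  have hZn : ‖Zpc χ x s'‖ ≤ 4 * B ^ (-u) := hZ
  have hXn : ‖(((bigP D ^ z : ℝ) : ℂ)) ^ ((u : ℂ) + (v : ℂ) * I)‖ = (bigP D ^ z) ^ u := by
    rw [Complex.norm_cpow_eq_rpow_re_of_pos hX]; simp
  have hT := norm_tailPc_le χ x hre hP1one hu1 v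
  have hω : ‖omega1 (ell D ^ 30) ((u : ℂ) + (v : ℂ) * I)‖ =
      Real.exp ((u ^ 2 - v ^ 2) / (4 * ell D ^ 30)) := norm_omega1 _ u v
  have hw1 : 1 ≤ ‖(u : ℂ) + (v : ℂ) * I‖ := by
    have h := Complex.abs_re_le_norm ((u : ℂ) + (v : ℂ) * I)
    have hure : ((u : ℂ) + (v : ℂ) * I).re = u := by simp
    rw [hure, abs_of_nonpos (by linarith)] at h
    linarith
  -- the tail `3P₁^{1/2+u} = 3√P₁·P₁^u`
  have hTsplit : Skeleton.P1 D ^ (1 / 2 + u) = Real.sqrt (Skeleton.P1 D) * Skeleton.P1 D ^ u := by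
    rw [Real.rpow_add hP10, Real.sqrt_eq_rpow]
  -- assemble
  have e : integrandTail χ x (bigP D ^ z) (Skeleton.P1 D) s ((u : ℂ) + (v : ℂ) * I) =
      Zpc χ x s' * tailPc χ x (Skeleton.P1 D) s ((u : ℂ) + (v : ℂ) * I) *
        ((((bigP D ^ z : ℝ) : ℂ)) ^ ((u : ℂ) + (v : ℂ) * I) * omega1 (ell D ^ 30) ((u : ℂ) + (v : ℂ) * I)) /
          ((u : ℂ) + (v : ℂ) * I) := by
    rw [integrandTail, kern, hs']; ring
  have hnum0 : 0 ≤ 4 * B ^ (-u) * (3 * Skeleton.P1 D ^ (1 / 2 + u)) *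
      ((bigP D ^ z) ^ u * Real.exp ((u ^ 2 - v ^ 2) / (4 * ell D ^ 30))) := by
    have := Real.rpow_nonneg hB0.le (-u)
    have := Real.rpow_nonneg hP10.le (1 / 2 + u)
    have := Real.rpow_nonneg hX.le u
    positivity
  calc ‖integrandTail χ x (bigP D ^ z) (Skeleton.P1 D) s ((u : ℂ) + (v : ℂ) * I)‖
      = ‖Zpc χ x s'‖ * ‖tailPc χ x (Skeleton.P1 D) s ((u : ℂ) + (v : ℂ) * I)‖ *
          ((bigP D ^ z) ^ u * Real.exp ((u ^ 2 - v ^ 2) / (4 * ell D ^ 30))) /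
            ‖(u : ℂ) + (v : ℂ) * I‖ := by
        rw [e, norm_div, norm_mul, norm_mul, norm_mul, hXn, hω]
    _ ≤ 4 * B ^ (-u) * (3 * Skeleton.P1 D ^ (1 / 2 + u)) *
          ((bigP D ^ z) ^ u * Real.exp ((u ^ 2 - v ^ 2) / (4 * ell D ^ 30))) /
            ‖(u : ℂ) + (v : ℂ) * I‖ := by
        gcongr
    _ ≤ 4 * B ^ (-u) * (3 * Skeleton.P1 D ^ (1 / 2 + u)) *
          ((bigP D ^ z) ^ u * Real.exp ((u ^ 2 - v ^ 2) / (4 * ell D ^ 30))) := div_le_self hnum0 hw1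
    _ = 12 * Real.sqrt (Skeleton.P1 D) * (B ^ (-u) * ((bigP D ^ z) ^ u * Skeleton.P1 D ^ u)) *
          Real.exp ((u ^ 2 - v ^ 2) / (4 * ell D ^ 30)) := by rw [hTsplit]; ring
    _ = 12 * Real.sqrt (Skeleton.P1 D) * (B / (bigP D ^ z * Skeleton.P1 D)) ^ (-u) *
          Real.exp ((u ^ 2 - v ^ 2) / (4 * ell D ^ 30)) := by rw [rpow_ratio_eq hB0 hX hP10]
    _ ≤ 12 * Real.sqrt (Skeleton.P1 D) * Real.exp (ell D * u) *
          Real.exp ((u ^ 2 - v ^ 2) / (4 * ell D ^ 30)) := by gcongr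

end BlockD

end Literature.NumberTheory.LFunctions.Zhang2022.Section11AFE
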